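/-
Copyright (c) 2026 the pub-hodgecm-mathlib formalisation cell (harness21).  Prover seat hodgecm-mathlib-LH4-p07 (g5): Track A «(D-RAM) FOUR-FRAME» squad of crux H413, unit
U3_Laws, (KMS) road «MODULO κ-STAGE B», brick κB-H₂ «CORE-HANGING κ AT TYPE 2, CLASS SIDE», FILE (A2₂) (dealer LH4-plan (g11) WORD #55 (2); letter of record LH4-p06 (g3)
`LETTER-kappaBH-tv2.v1.LH4p06g3.md` 44d44a13 §3, κ owner LH4-p05 (g3) «=» 2026-09-04T02:22:07Z; cross-read LH4-p09 (g3) 4ddd76e2; oracle LH4-r01 (g4) GB 44∕44 at q = 4), 2026-09-04.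
-/
import Summits.HodgeConjecture.HodgeConjecture.Theorems.F0P3cDyRamDiagonalKappaCoreHangingTwoForms      -- FILE (A1₂) (this seat): `kappaCount_eq_zero_of_exists_mem_fixedUnitStabilizer`, `kappaCount_two_latt_coreHanging_eq_finsum_table`, `near_letters_table`; brings ★ (iii)₂(b), ★ (iii)₂(a) `ncard_reps_near_eq`, ★ `exists_fixed_class_representatives`, ★ Fκ1∕Fκ2
import Summits.HodgeConjecture.HodgeConjecture.Theorems.F0P3cDyRamDiagonalKappaCoreHangingCornerWindow  -- ★ p856803 FILE (W) (LH4-p06 (g3)): the window at corner depth `e` (`chiVec_eq_one_of_mem_fixedUnitStabilizer_corner`, `exists_mem_fixedUnitStabilizer_chiVec_ne_one_corner`); brings ★ κH-A2 p856713 (`two_le_d_of_v_two_lt_one`, `chiVec_apply`), ★ toolkit p856540, ★ `normSign_mul_self`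
import Summits.HodgeConjecture.HodgeConjecture.Theorems.F0P3cDyRamDiagonalKappaCoreHangingCharacterMaps  -- ★ p856714 κH-B1a (LH4-p06 (g3)): `sum_normSign_eq_zero_of_repr_ball`, `v_add_eq_one_of_lt`
import Summits.HodgeConjecture.HodgeConjecture.Theorems.F0P3cDyRamDiagonalGluedRhoZero                   -- ★ (F0P3-p01 (g31)): `mem_latticeStabilizer_latt_rhoZero_iff` (`S_F` of the root-glued frame, for `H(1)`)
import HarnessLib

/-!
# Crux `H413`, (KMS) ROAD «MODULO κ-STAGE B», brick κB-H₂ FILE (A2₂): THE TYPE-2 κ-COUNT OF A CORE-HANGING FRAME LATTICE —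
# `kappaCount σ ϖ 2 i (latt V₂) = [2d−1 ≤ ρ]·n₂(ρ)·χ^H_i(f)` on the unit-torus orbit of `latt V₂(1,1,f)`, and `= 0` on the root stratum `H(1)`

Cell `hodgecm-mathlib` (D-0151), FLOOR 0, crux item H413 = `stmt-HodgeConjecture-24833`; lane `--supports stmt-HodgeConjecture-24833 --as helper` (count-neutral).  THEOREMS ONLY
(no `def`, no instance, no notation, no `sorry`, default heartbeats).  Letter of record LH4-p06 (g3) 44d44a13 §3 (κ owner LH4-p05 (g3) «=»; LH4-p09 (g3) 4ddd76e2 «=» on the class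
values; LH4-r01 (g4) per-class oracle GB at the `q = 4`, `d = 2` cell: 44∕44); interface (by-paste prelude a20a711f) consumed BY NAME by LH4-p08 (g3)'s FILE (B2₂)
`…KappaCoreHangingTwoSocket`.  Type-2 twin of ★ p856713 κH-A2 `…KappaCoreHangingClass`.

THE MATHEMATICS.  `V₂ = (1 0 0; x ϖ^ρ 0; xζ + f·xζ ϖ^ρζ ϖ^{2ρ+1})`, `ρ ≥ 1`, `x, ζ` units, `f` a FIXED unit with `|1+f| = 1` (the exact invariant; every member of the unit-torus orbit of
`latt V₂(1,1,f)` has this shape, ★ (A)).  `χ^H(f) = (ω(−(1+f)), ω(f)ω(−(1+f)), ω(f))` — the SAME vector as at `tv = 0`.  `n₂(ρ) = q^{(ρ+2)∕2 − (ρ+1)∕2}` (★ (iii)₂(b)).  By FILE (A1₂),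
when the window is alive `kappaCount σ ϖ 2 i (latt V₂) = Σᶠ_{φ ∈ R₀} (ω(−(Nζ+φ)), ω(h̃ φ), ω(h̃ φ)ω(−(Nζ+φ)))_i` over the class `R₀ = {φ ∈ R : |φ − fNζ| ≤ |ϖ|^ρ}` of a complete
irredundant system `R` modulo `𝔭^{ρ+1}`; by ★ FILE (W) at corner depth `e = 1` the window is alive iff `2d−1 ≤ ρ+1` (`S_F` is one level deeper than at `tv = 0`).
* §2 TRANSPORT BY ISOMETRY + PIGEONHOLE (`finsum_normSign_eq_zero_of_isometry`): at `ρ = 2d−2`, for a map `F` carrying the fixed units of the ball `B(a₀, ρ)` into the ball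
  `B(b₀, ρ)` without contracting distances, `Σ_{φ ∈ R₀} ω(F φ) = 0` — `φ ↦ rep(F φ)` is an injection `R₀ → R₁ = R ∩ B(b₀, ρ)` between sets of the same size `n₂(ρ)` (★ (iii)₂(a)
  twice), hence onto; `ω(F φ) = ω(rep(F φ))` (toolkit §3 at level `ρ+1 = 2d−1`); `Σ_{R₁} ω = 0` (★ B1a `sum_normSign_eq_zero_of_repr_ball`, radius exponent `ρ = 2d−2`).  No Hensel step.
* §3 THE CLASS SUMS by regime: (b) `2d−1 ≤ ρ` — every entry is `χ^H_i(f)` (near letters at depth `ρ ≥ 2d−1`; `Nζ` a norm; `ω` multiplicative on fixed scalars), so the sum is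
  `n₂(ρ)·χ^H_i(f)` (★ (iii)₂(a) counts `R₀`); (c) `ρ = 2d−2` (alive, `n₂ = q`) — the three sums VANISH by §2 with `F = φ ↦ −(Nζ+φ)` (slot 0), `φ ↦ h(φ) = φ − fNζ(2+f)` (slot 1,
  after `ω(h̃ φ) = ω(h φ)` at depth `2ρ ≥ 2d−1`) and `φ ↦ h(φ)·(−(Nζ+φ))` (slot 2 — an isometry of the ball because `|h(φ) + Nζ + φ′| = |1 − f| = 1`; HERE `|2| < 1 = |1+f|` is used).
* §4 HEAD `kappaCount_two_latt_coreHanging_eq` (regimes (b) ∕ (c) ∕ (a) = dead `ρ ≤ 2d−3` by ★ (W) + A1₂ §0); §5 `kappaCount_two_latt_rhoZeroH_eq_zero` (`ρ = 0`: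
  `S_F(latt W) = {u₀ ≡ u₁ ≡ u₂ (𝔭)}` ∋ `(1,c,1)`, `(c,1,1)` — dead for `d ≥ 2`, although `polarisationCount = q − 2`, ★ (H1b)).
HONEST LABEL.  Count-neutral; `HC_CM` is proved only modulo the 7 printed citations (2 remaining named inputs: hLiu418 = `stmt-HodgeConjecture-24832`, h413 = `stmt-HodgeConjecture-24833`)
until rung 0 closes.

## References
* [Kottwitz1986BaseChangeUnits] R. Kottwitz, *Base change for unit elements of Hecke algebras*, Compositio Math. 60 (1986), §1 pp. 240–241 (κ-orbital integrals as signed lattice counts).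
* [Rogawski1990] J. D. Rogawski, *Automorphic Representations of Unitary Groups in Three Variables*, Ann. of Math. Stud. 123 (1990), §4.9 Prop. 4.9.1 (a) p. 55; §4.10 p. 58.
* [LanglandsShelstad1987] R. P. Langlands, D. Shelstad, *On the definition of transfer factors*, Math. Ann. 278 (1987), §3.
* [Serre1979] J.-P. Serre, *Local Fields*, GTM 67 (1979), Ch. IV §2 Prop. 6, Ch. V §3 Cor. 3, Ch. XV §2 (unit filtration, norm classes, conductor of the quadratic character).
-/

set_option autoImplicit false

noncomputable section

namespace Summit.HodgeConjecture.HodgeConjecture.Cruxes.H413.F0P3cDyRamDiagonalKappaCoreHangingTwoClass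

open Matrix WithZero
open Literature.NumberTheory.Automorphic Literature.NumberTheory.Automorphic.HermitianLattice Literature.NumberTheory.Automorphic.UnitaryGroup
open Literature.NumberTheory.Automorphic.UnitaryLatticeTree Literature.NumberTheory.Automorphic.UnitaryThreeFourFrame
open Literature.NumberTheory.LocalFields.WildQuadraticDatum
open Summit.HodgeConjecture.HodgeConjecture.Cruxes.H413.F0P3cDyRamDiagonalTorusDefs
open Summit.HodgeConjecture.HodgeConjecture.Cruxes.H413.F0P3cDyRamDiagonalStrataDefs
open Summit.HodgeConjecture.HodgeConjecture.Cruxes.H413.F0P3cDyRamDiagonalGluedStabiliserIndex (ne_zero_and_v_lt_one_of_v_eq_exp)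
open Summit.HodgeConjecture.HodgeConjecture.Cruxes.H413.F0P3cDyRamDiagonalGluedRhoZero (mem_latticeStabilizer_latt_rhoZero_iff)
open Summit.HodgeConjecture.HodgeConjecture.Cruxes.H413.F0P3cDyRamDiagonalGluedClassRepresentatives (exists_fixed_class_representatives)
open Summit.HodgeConjecture.HodgeConjecture.Cruxes.H413.F0P3cDyRamDiagonalFixedClassRefinementCount (ncard_reps_near_eq)
open Summit.HodgeConjecture.HodgeConjecture.Cruxes.H413.F0P3cDyRamDiagonalKappaCountDefs
open Summit.HodgeConjecture.HodgeConjecture.Cruxes.H413.F0P3cDyRamDiagonalKappaCountEval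
open Summit.HodgeConjecture.HodgeConjecture.Cruxes.H413.F0P3cDyRamDiagonalKappaCoreHangingClass (two_le_d_of_v_two_lt_one chiVec_apply)
open Summit.HodgeConjecture.HodgeConjecture.Cruxes.H413.F0P3cDyRamDiagonalKappaCoreHangingCornerWindow
open Summit.HodgeConjecture.HodgeConjecture.Cruxes.H413.F0P3cDyRamDiagonalKappaCoreHangingCharacterMaps (sum_normSign_eq_zero_of_repr_ball v_add_eq_one_of_lt)
open Summit.HodgeConjecture.HodgeConjecture.Cruxes.H413.F0P3cDyRamDiagonalKappaCoreHangingTwoForms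
open Summit.HodgeConjecture.HodgeConjecture.Cruxes.H413.F0P3cDyRamDiagonalKappaSplitCountEval (normSign_mul_self)
open Summit.HodgeConjecture.HodgeConjecture.Cruxes.H413.F0P3cDyRamFixedCountDiagonalModel (normSign_mul_norm)
open scoped Valued WithZero Matrix MatrixGroups

variable {K : Type} [Field K] [Valued K ℤᵐ⁰]

/-! ## §2  Transport of a class sum along an expanding map, and the pigeonhole at `ρ = 2d − 2` -/

/-- **`Σ_{φ ∈ R₀} ω(F φ) = 0` BY ISOMETRY + PIGEONHOLE** (complete `K`, finite residue field, `|2| < 1`, `ρ ≥ 1`, `2d−1 ≤ ρ+1`, `ρ ≤ 2d−2`).  `R` is a complete irredundant system of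
fixed units modulo `𝔭^{ρ+1}`, `R₀ = {φ ∈ R : |φ − a₀| ≤ |ϖ|^ρ}` the class of the fixed unit `a₀`, and `F` maps the fixed units of the ball `B(a₀, ρ)` to fixed units of the ball
`B(b₀, ρ)` (`b₀` a fixed unit) WITHOUT CONTRACTING distances (`|φ − φ′| ≤ |F φ − F φ′|`).  Then `φ ↦ rep(F φ)` is an injection `R₀ → R₁ = {g ∈ R : |g − b₀| ≤ |ϖ|^ρ}` between sets
of the same size `q^{(ρ+2)∕2 − (ρ+1)∕2}` (★ (iii)₂(a) `ncard_reps_near_eq`, twice), hence a bijection; `ω(F φ) = ω(rep(F φ))` (toolkit §3 at level `ρ+1 ≥ 2d−1`), and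
`Σ_{R₁} ω = 0` (★ B1a `sum_normSign_eq_zero_of_repr_ball`: the ball has radius exponent `ρ ≤ 2d−2`). [cite: Serre1979, Ch. IV §2 Prop. 6; Ch. XV §2] [cite: Kottwitz1986BaseChangeUnits, §1 pp. 240–241] -/
theorem finsum_normSign_eq_zero_of_isometry [CompleteSpace K] [Finite 𝓀[K]] {σ : K →+* K} {ϖ : K} {d t : ℕ}
    (hD : IsRamifiedQuadraticDatum σ ϖ d t) (h2 : Valued.v (2 : K) < 1) {ρ : ℕ} (hρ : 1 ≤ ρ) (hρ1 : 2 * d - 1 ≤ ρ + 1) (hρ2 : ρ ≤ 2 * d - 2)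
    {R : Set K} (hRfin : R.Finite) (hR1 : ∀ g ∈ R, σ g = g ∧ Valued.v g = 1)
    (hR2 : ∀ f' : K, σ f' = f' → Valued.v f' = 1 → ∃ g ∈ R, Valued.v (f' - g) ≤ Valued.v ϖ ^ (ρ + 1))
    (hR3 : ∀ g ∈ R, ∀ g' ∈ R, Valued.v (g - g') ≤ Valued.v ϖ ^ (ρ + 1) → g = g')
    {a₀ b₀ : K} (hσa₀ : σ a₀ = a₀) (ha₀ : Valued.v a₀ = 1) (hσb₀ : σ b₀ = b₀) (hb₀ : Valued.v b₀ = 1) (F : K → K)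
    (hF : ∀ φ : K, σ φ = φ → Valued.v φ = 1 → Valued.v (φ - a₀) ≤ Valued.v ϖ ^ ρ →
      σ (F φ) = F φ ∧ Valued.v (F φ) = 1 ∧ Valued.v (F φ - b₀) ≤ Valued.v ϖ ^ ρ)
    (hFiso : ∀ φ φ' : K, σ φ = φ → Valued.v φ = 1 → Valued.v (φ - a₀) ≤ Valued.v ϖ ^ ρ → σ φ' = φ' → Valued.v φ' = 1 → Valued.v (φ' - a₀) ≤ Valued.v ϖ ^ ρ →
      Valued.v (φ - φ') ≤ Valued.v (F φ - F φ')) :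
    ∑ᶠ φ ∈ {φ ∈ R | Valued.v (φ - a₀) ≤ Valued.v ϖ ^ ρ}, normSign σ (F φ) = 0 := by
  classical
  obtain ⟨hσ, hvσ, hϖ, hfix, hd, -, -⟩ := id hD
  obtain ⟨-, hϖ1⟩ := ne_zero_and_v_lt_one_of_v_eq_exp hϖ
  have hϖle : Valued.v ϖ ^ (ρ + 1) ≤ Valued.v ϖ ^ ρ := pow_le_pow_right_of_le_one' hϖ1.le (by omega)
  set R₀ : Set K := {φ ∈ R | Valued.v (φ - a₀) ≤ Valued.v ϖ ^ ρ} with hR₀def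
  set R₁ : Set K := {g ∈ R | Valued.v (g - b₀) ≤ Valued.v ϖ ^ ρ} with hR₁def
  have hR₀fin : R₀.Finite := hRfin.subset (Set.sep_subset _ _)
  have hR₁fin : R₁.Finite := hRfin.subset (Set.sep_subset _ _)
  have hcount : R₀.ncard = R₁.ncard := by
    rw [hR₀def, hR₁def, ncard_reps_near_eq hσ hvσ hfix hϖ hd hρ hRfin hR1 hR2 hR3 hσa₀ ha₀, ncard_reps_near_eq hσ hvσ hfix hϖ hd hρ hRfin hR1 hR2 hR3 hσb₀ hb₀]
  -- a near representative of a fixed unit of the ball `B(b₀, ρ)` lies in `R₁`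
  have hnearR₁ : ∀ {w g : K}, Valued.v (w - b₀) ≤ Valued.v ϖ ^ ρ → g ∈ R → Valued.v (w - g) ≤ Valued.v ϖ ^ (ρ + 1) → g ∈ R₁ := fun {w g} hw hgR hwg => by
    refine ⟨hgR, ?_⟩
    rw [show g - b₀ = (w - b₀) + -(w - g) by ring]
    exact (Valuation.map_add _ _ _).trans (max_le hw (by rw [Valuation.map_neg]; exact hwg.trans hϖle))
  -- the representative of `F φ`
  have hrep : ∀ φ ∈ R₀, ∃ g ∈ R₁, Valued.v (F φ - g) ≤ Valued.v ϖ ^ (ρ + 1) := by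
    rintro φ ⟨hφR, hφa⟩
    obtain ⟨hσφ, hvφ⟩ := hR1 φ hφR
    obtain ⟨hσF, hvF, hFb⟩ := hF φ hσφ hvφ hφa
    obtain ⟨g, hgR, hFg⟩ := hR2 (F φ) hσF hvF
    exact ⟨g, hnearR₁ hFb hgR hFg, hFg⟩
  choose! r hrR₁ hr using hrep
  -- `ω(F φ) = ω(r φ)` (level `ρ+1 ≥ 2d−1`)
  have hω : ∀ φ ∈ R₀, normSign σ (F φ) = normSign σ (r φ) := by
    rintro φ hφ
    obtain ⟨hσφ, hvφ⟩ := hR1 φ hφ.1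
    obtain ⟨hσF, hvF, -⟩ := hF φ hσφ hvφ hφ.2
    exact (normSign_eq_of_near hD hσF (hR1 _ (hrR₁ φ hφ).1).1 hvF hρ1 (hr φ hφ)).symm
  -- `r` is injective on `R₀` (no contraction + irredundance), hence onto `R₁` by counting
  have hinj : Set.InjOn r R₀ := by
    rintro φ hφ φ' hφ' heq
    obtain ⟨hσφ, hvφ⟩ := hR1 φ hφ.1
    obtain ⟨hσφ', hvφ'⟩ := hR1 φ' hφ'.1
    apply hR3 φ hφ.1 φ' hφ'.1
    refine (hFiso φ φ' hσφ hvφ hφ.2 hσφ' hvφ' hφ'.2).trans ?_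
    rw [show F φ - F φ' = (F φ - r φ) + -(F φ' - r φ') by rw [heq]; ring]
    exact (Valuation.map_add _ _ _).trans (max_le (hr φ hφ) (by rw [Valuation.map_neg]; exact hr φ' hφ'))
  have himage : r '' R₀ = R₁ :=
    Set.eq_of_subset_of_ncard_le (Set.image_subset_iff.2 fun φ hφ => hrR₁ φ hφ) (by rw [← hcount, hinj.ncard_image]) hR₁fin
  -- transport and kill
  rw [finsum_mem_congr rfl hω, ← finsum_mem_image hinj, himage, finsum_mem_eq_finite_toFinset_sum _ hR₁fin]
  refine sum_normSign_eq_zero_of_repr_ball hD h2 hρ1 hb₀ hρ2 hR₁fin.toFinset (fun g hg => ?_) (fun w hσw hvw hwb => ?_) (fun g hg g' hg' hgg' => ?_)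
  · obtain ⟨hgR, hgb⟩ := (Set.Finite.mem_toFinset _).1 hg
    exact ⟨(hR1 g hgR).1, (hR1 g hgR).2, hgb⟩
  · obtain ⟨g, hgR, hwg⟩ := hR2 w hσw hvw
    exact ⟨g, (Set.Finite.mem_toFinset _).2 (hnearR₁ hwb hgR hwg), hwg⟩
  · exact hR3 g ((Set.Finite.mem_toFinset _).1 hg).1 g' ((Set.Finite.mem_toFinset _).1 hg').1 hgg'

/-! ## §3  The class sums of the A1₂ table, by regime -/

/-- Letters of the centre: for units `ζ, f` with `f` fixed and `|1+f| = 1`, the elements `fNζ`, `−Nζ(1+f)`, `−fNζ(1+f)`, `fNζ²(1+f)²` are fixed units (`Nζ = ζσζ`).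
[cite: Serre1979, Ch. V §3] -/
theorem centre_letters {σ : K →+* K} (hσ : ∀ a, σ (σ a) = a) (hvσ : ∀ a, Valued.v (σ a) = Valued.v a) {ζ f : K}
    (hζ : Valued.v ζ = 1) (hσf : σ f = f) (hf : Valued.v f = 1) (h1f : Valued.v (1 + f) = 1) :
    (σ (f * (ζ * σ ζ)) = f * (ζ * σ ζ) ∧ Valued.v (f * (ζ * σ ζ)) = 1) ∧
    (σ (-(ζ * σ ζ * (1 + f))) = -(ζ * σ ζ * (1 + f)) ∧ Valued.v (-(ζ * σ ζ * (1 + f))) = 1) ∧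
    (σ (-(f * (ζ * σ ζ) * (1 + f))) = -(f * (ζ * σ ζ) * (1 + f)) ∧ Valued.v (-(f * (ζ * σ ζ) * (1 + f))) = 1) ∧
    (σ (f * (ζ * σ ζ) ^ 2 * (1 + f) ^ 2) = f * (ζ * σ ζ) ^ 2 * (1 + f) ^ 2 ∧ Valued.v (f * (ζ * σ ζ) ^ 2 * (1 + f) ^ 2) = 1) := by
  have hσN : σ (ζ * σ ζ) = ζ * σ ζ := by rw [map_mul, hσ, mul_comm]
  have hvN : Valued.v (ζ * σ ζ) = 1 := by rw [map_mul, hvσ, hζ, one_mul]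
  have hσ1f : σ (1 + f) = 1 + f := by rw [map_add, map_one, hσf]
  refine ⟨⟨by rw [map_mul, hσf, hσN], by rw [map_mul, hf, hvN, one_mul]⟩,
    ⟨by rw [map_neg, map_mul, hσN, hσ1f], by rw [Valuation.map_neg, map_mul, hvN, h1f, one_mul]⟩,
    ⟨by rw [map_neg, map_mul, map_mul, hσf, hσN, hσ1f], by rw [Valuation.map_neg, map_mul, map_mul, hf, hvN, h1f, one_mul, one_mul]⟩,
    ⟨by rw [map_mul, map_mul, map_pow, map_pow, hσf, hσN, hσ1f], by simp only [map_mul, map_pow, hf, hvN, h1f, one_pow, one_mul]⟩⟩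

/-- **REGIME (b), `2d−1 ≤ ρ`: every table entry is `χ^H_i(f)`** — for a fixed unit `φ` with `|φ − fNζ| ≤ |ϖ|^ρ`: `ω(−(Nζ+φ)) = ω(−(1+f))`, `ω(h̃ φ) = ω(f)·ω(−(1+f))`, hence
`(table)_i(φ) = (ω(−(1+f)), ω(f)ω(−(1+f)), ω(f))_i` (near letters at depth `ρ ≥ 2d−1`, toolkit §3; `Nζ` is a norm; `ω` multiplicative on fixed scalars).
[cite: Serre1979, Ch. XV §2] [cite: Rogawski1990, §4.10 p. 58] -/
theorem table_eq_chiH_of_le [CompleteSpace K] [Finite 𝓀[K]] {σ : K →+* K} {ϖ : K} {d t : ℕ} (hD : IsRamifiedQuadraticDatum σ ϖ d t)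
    {ρ : ℕ} (hρd : 2 * d - 1 ≤ ρ) {ζ f φ : K} (hζ : Valued.v ζ = 1) (hσf : σ f = f) (hf : Valued.v f = 1) (h1f : Valued.v (1 + f) = 1)
    (hσφ : σ φ = φ) (hvφ : Valued.v φ = 1) (hnear : Valued.v (φ - f * (ζ * σ ζ)) ≤ Valued.v ϖ ^ ρ) (i : Fin 3) :
    (![normSign σ (-(ζ * σ ζ + φ)), normSign σ (φ - f * (ζ * σ ζ) * (2 + f) - (f * (ζ * σ ζ) - φ) ^ 2 / φ),
        normSign σ (φ - f * (ζ * σ ζ) * (2 + f) - (f * (ζ * σ ζ) - φ) ^ 2 / φ) * normSign σ (-(ζ * σ ζ + φ))] : Fin 3 → ℤ) i =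
      (![normSign σ (-(1 + f)), normSign σ f * normSign σ (-(1 + f)), normSign σ f] : Fin 3 → ℤ) i := by
  obtain ⟨hσ, hvσ, hϖ, -, -, -, -⟩ := id hD
  obtain ⟨-, hϖ1⟩ := ne_zero_and_v_lt_one_of_v_eq_exp hϖ
  have hζ0 : ζ ≠ 0 := fun h => by rw [h, map_zero] at hζ; exact zero_ne_one hζ
  have hf0 : f ≠ 0 := fun h => by rw [h, map_zero] at hf; exact zero_ne_one hf
  have h1f0 : 1 + f ≠ 0 := fun h => by rw [h, map_zero] at h1f; exact zero_ne_one h1f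
  obtain ⟨-, ⟨hσb, hvb⟩, ⟨hσc, hvc⟩, -⟩ := centre_letters hσ hvσ hζ hσf hf h1f
  obtain ⟨e1, -, -, e4⟩ := near_letters_table (σ := σ) hϖ1.le (ρ := ρ) (ζ := ζ) (f := f) hvφ hnear
  -- the σ-fixedness of the two table arguments
  have hσNφ : σ (-(ζ * σ ζ + φ)) = -(ζ * σ ζ + φ) := by rw [map_neg, map_add, map_mul, hσ, mul_comm (σ ζ) ζ, hσφ]
  have hσH : σ (φ - f * (ζ * σ ζ) * (2 + f) - (f * (ζ * σ ζ) - φ) ^ 2 / φ) = φ - f * (ζ * σ ζ) * (2 + f) - (f * (ζ * σ ζ) - φ) ^ 2 / φ := by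
    simp only [map_sub, map_mul, map_add, map_div₀, map_pow, map_ofNat, hσ, hσf, hσφ, mul_comm (σ ζ) ζ]
  -- slot letters
  have hω1 : normSign σ (-(ζ * σ ζ + φ)) = normSign σ (-(1 + f)) := by
    rw [normSign_eq_of_near hD hσb hσNφ hvb hρd (by rw [show -(ζ * σ ζ * (1 + f)) - -(ζ * σ ζ + φ) = φ - f * (ζ * σ ζ) by ring]; exact hnear),
      show -(ζ * σ ζ * (1 + f)) = -(1 + f) * (ζ * σ ζ) by ring]
    exact normSign_mul_norm σ _ hζ0
  have hω0 : normSign σ (φ - f * (ζ * σ ζ) * (2 + f) - (f * (ζ * σ ζ) - φ) ^ 2 / φ) = normSign σ f * normSign σ (-(1 + f)) := by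
    rw [normSign_eq_of_near hD hσc hσH hvc hρd (by rw [← Valuation.map_neg, neg_sub]; exact e4),
      show -(f * (ζ * σ ζ) * (1 + f)) = f * -(1 + f) * (ζ * σ ζ) by ring, normSign_mul_norm σ _ hζ0]
    exact normSign_mul_of_fixed hD hσf (by rw [map_neg, map_add, map_one, hσf]) hf0 (neg_ne_zero.2 h1f0)
  fin_cases i
  · simp only [Fin.zero_eta, Fin.isValue, cons_val_zero]; exact hω1
  · simp only [Fin.mk_one, Fin.isValue, cons_val_one, cons_val_zero]; exact hω0
  · simp only [Fin.reduceFinMk, cons_val_two, Nat.succ_eq_add_one, Nat.reduceAdd, tail_cons, head_cons]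
    rw [hω0, hω1, mul_assoc, normSign_mul_self σ _, mul_one]

/-- **REGIME (c), `ρ = 2d−2` (`2d−1 ≤ ρ+1`, `ρ ≤ 2d−2`): each of the three class sums over `R₀` VANISHES** — §2 with `F = φ ↦ −(Nζ+φ)` (slot 0), `φ ↦ h(φ) = φ − fNζ(2+f)` (slot 1, after
`ω(h̃ φ) = ω(h φ)` at depth `2ρ ≥ 2d−1`) and `φ ↦ h(φ)·(−(Nζ+φ))` (slot 2; an isometry of the ball since `|h(φ) + Nζ + φ′| = |1 − f| = 1`, using `|2| < 1 = |1+f|`).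
[cite: Serre1979, Ch. IV §2 Prop. 6; Ch. XV §2] [cite: Kottwitz1986BaseChangeUnits, §1 pp. 240–241] [cite: LanglandsShelstad1987, §3] -/
theorem finsum_table_eq_zero_of_boundary [CompleteSpace K] [Finite 𝓀[K]] {σ : K →+* K} {ϖ : K} {d t : ℕ}
    (hD : IsRamifiedQuadraticDatum σ ϖ d t) (h2 : Valued.v (2 : K) < 1) {ρ : ℕ} (hρ : 1 ≤ ρ) (hρ1 : 2 * d - 1 ≤ ρ + 1) (hρ2 : ρ ≤ 2 * d - 2)
    {ζ f : K} (hζ : Valued.v ζ = 1) (hσf : σ f = f) (hf : Valued.v f = 1) (h1f : Valued.v (1 + f) = 1)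
    {R : Set K} (hRfin : R.Finite) (hR1 : ∀ g ∈ R, σ g = g ∧ Valued.v g = 1)
    (hR2 : ∀ f' : K, σ f' = f' → Valued.v f' = 1 → ∃ g ∈ R, Valued.v (f' - g) ≤ Valued.v ϖ ^ (ρ + 1))
    (hR3 : ∀ g ∈ R, ∀ g' ∈ R, Valued.v (g - g') ≤ Valued.v ϖ ^ (ρ + 1) → g = g') (i : Fin 3) :
    ∑ᶠ φ ∈ {φ ∈ R | Valued.v (φ - f * (ζ * σ ζ)) ≤ Valued.v ϖ ^ ρ},
      (![normSign σ (-(ζ * σ ζ + φ)), normSign σ (φ - f * (ζ * σ ζ) * (2 + f) - (f * (ζ * σ ζ) - φ) ^ 2 / φ),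
         normSign σ (φ - f * (ζ * σ ζ) * (2 + f) - (f * (ζ * σ ζ) - φ) ^ 2 / φ) * normSign σ (-(ζ * σ ζ + φ))] : Fin 3 → ℤ) i = 0 := by
  obtain ⟨hσ, hvσ, hϖ, -, -, -, -⟩ := id hD
  obtain ⟨-, hϖ1⟩ := ne_zero_and_v_lt_one_of_v_eq_exp hϖ
  have hϖρ1 : Valued.v ϖ ^ ρ < 1 := pow_lt_one₀ zero_le hϖ1 (by omega)
  have h2ρ : 2 * d - 1 ≤ 2 * ρ := by omega
  obtain ⟨⟨hσa, hva⟩, ⟨hσb, hvb⟩, ⟨hσc, hvc⟩, ⟨hσq, hvq⟩⟩ := centre_letters hσ hvσ hζ hσf hf h1f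
  set a₀ : K := f * (ζ * σ ζ) with ha₀
  set Nζ : K := ζ * σ ζ with hNζ
  have hσN : σ Nζ = Nζ := by rw [hNζ, map_mul, hσ, mul_comm]
  -- `|1 − f| = 1` (residue characteristic 2: `1 − f = −(1+f) + 2`)
  have h1mf : Valued.v (1 - f) = 1 := by
    rw [show (1 : K) - f = -(1 + f) + 2 by ring]; exact v_add_eq_one_of_lt (by rw [Valuation.map_neg, h1f]) h2
  have hvu : Valued.v (Nζ * ((1 - f) * (1 + f))) = 1 := by simp only [hNζ, map_mul, hvσ, hζ, h1mf, h1f, one_mul]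
  -- generic letters of a fixed unit `φ` of the ball
  have hball : ∀ {φ : K}, σ φ = φ → Valued.v φ = 1 → Valued.v (φ - a₀) ≤ Valued.v ϖ ^ ρ →
      (σ (-(Nζ + φ)) = -(Nζ + φ) ∧ Valued.v (-(Nζ + φ)) = 1 ∧ Valued.v (-(Nζ + φ) - -(Nζ * (1 + f))) ≤ Valued.v ϖ ^ ρ) ∧
      (σ (φ - f * Nζ * (2 + f)) = φ - f * Nζ * (2 + f) ∧ Valued.v (φ - f * Nζ * (2 + f)) = 1 ∧
        Valued.v ((φ - f * Nζ * (2 + f)) - -(f * Nζ * (1 + f))) ≤ Valued.v ϖ ^ ρ) := fun {φ} hσφ hvφ hφa => by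
    obtain ⟨e1, e2, -, -⟩ := near_letters_table (σ := σ) hϖ1.le (ρ := ρ) (ζ := ζ) (f := f) hvφ hφa
    refine ⟨⟨by rw [map_neg, map_add, hσN, hσφ], ?_, by rw [e1, Valuation.map_neg]; exact hφa⟩,
      ⟨by rw [map_sub, map_mul, map_mul, map_add, map_ofNat, hσf, hσN, hσφ], ?_, by rw [e2]; exact hφa⟩⟩
    · rw [show -(Nζ + φ) = -(Nζ * (1 + f)) + -(φ - a₀) by rw [ha₀]; ring]
      exact v_add_eq_one_of_lt hvb (by rw [Valuation.map_neg]; exact hφa.trans_lt hϖρ1)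
    · rw [show φ - f * Nζ * (2 + f) = -(f * Nζ * (1 + f)) + (φ - a₀) by rw [ha₀]; ring]
      exact v_add_eq_one_of_lt hvc (hφa.trans_lt hϖρ1)
  fin_cases i
  · -- slot 0: `F φ = −(Nζ + φ)`, an isometry onto the ball around `−Nζ(1+f)`
    simp only [Fin.zero_eta, Fin.isValue, cons_val_zero]
    refine finsum_normSign_eq_zero_of_isometry hD h2 hρ hρ1 hρ2 hRfin hR1 hR2 hR3 hσa hva hσb hvb (fun φ => -(Nζ + φ))
      (fun φ hσφ hvφ hφa => (hball hσφ hvφ hφa).1) (fun φ φ' _ _ _ _ _ _ => ?_)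
    rw [show -(Nζ + φ) - -(Nζ + φ') = -(φ - φ') by ring, Valuation.map_neg]
  · -- slot 1: `ω(h̃ φ) = ω(h φ)` (depth `2ρ`), then `F = h`, a translation
    simp only [Fin.mk_one, Fin.isValue, cons_val_one, cons_val_zero]
    rw [finsum_mem_congr rfl fun φ hφ => (?_ :
      normSign σ (φ - f * (ζ * σ ζ) * (2 + f) - (f * (ζ * σ ζ) - φ) ^ 2 / φ) = normSign σ (φ - f * Nζ * (2 + f)))]
    · refine finsum_normSign_eq_zero_of_isometry hD h2 hρ hρ1 hρ2 hRfin hR1 hR2 hR3 hσa hva hσc hvc (fun φ => φ - f * Nζ * (2 + f))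
        (fun φ hσφ hvφ hφa => (hball hσφ hvφ hφa).2) (fun φ φ' _ _ _ _ _ _ => ?_)
      rw [show φ - f * Nζ * (2 + f) - (φ' - f * Nζ * (2 + f)) = φ - φ' by ring]
    · obtain ⟨hσφ, hvφ⟩ := hR1 φ hφ.1
      obtain ⟨-, ⟨hσh, hvh, -⟩⟩ := hball hσφ hvφ hφ.2
      obtain ⟨-, -, e3, -⟩ := near_letters_table (σ := σ) hϖ1.le (ρ := ρ) (ζ := ζ) (f := f) hvφ hφ.2
      have hσH : σ (φ - f * (ζ * σ ζ) * (2 + f) - (f * (ζ * σ ζ) - φ) ^ 2 / φ) = φ - f * (ζ * σ ζ) * (2 + f) - (f * (ζ * σ ζ) - φ) ^ 2 / φ := by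
        simp only [map_sub, map_mul, map_add, map_div₀, map_pow, map_ofNat, hσ, hσf, hσφ, mul_comm (σ ζ) ζ]
      exact normSign_eq_of_near hD hσh hσH hvh h2ρ (by rw [← Valuation.map_neg, neg_sub]; exact e3)
  · -- slot 2: `ω(h̃ φ)·ω(−(Nζ+φ)) = ω(h φ · (−(Nζ+φ)))`, and `φ ↦ h(φ)·(−(Nζ+φ))` is an isometry of the ball
    simp only [Fin.reduceFinMk, cons_val_two, Nat.succ_eq_add_one, Nat.reduceAdd, tail_cons, head_cons]
    rw [finsum_mem_congr rfl fun φ hφ => (?_ :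
      normSign σ (φ - f * (ζ * σ ζ) * (2 + f) - (f * (ζ * σ ζ) - φ) ^ 2 / φ) * normSign σ (-(ζ * σ ζ + φ)) =
        normSign σ ((φ - f * Nζ * (2 + f)) * (-(Nζ + φ))))]
    · refine finsum_normSign_eq_zero_of_isometry hD h2 hρ hρ1 hρ2 hRfin hR1 hR2 hR3 hσa hva hσq hvq (fun φ => (φ - f * Nζ * (2 + f)) * (-(Nζ + φ)))
        (fun φ hσφ hvφ hφa => ?_) (fun φ φ' hσφ hvφ hφa hσφ' hvφ' hφ'a => ?_)
      · obtain ⟨⟨hσn, hvn, -⟩, ⟨hσh, hvh, -⟩⟩ := hball hσφ hvφ hφa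
        refine ⟨by rw [map_mul, hσh, hσn], by rw [map_mul, hvh, hvn, one_mul], ?_⟩
        -- `F φ − F a₀ = −(φ − a₀)·(h φ + Nζ + a₀)` and `|h φ + Nζ + a₀| ≤ 1`
        have e : (φ - f * Nζ * (2 + f)) * (-(Nζ + φ)) - f * (ζ * σ ζ) ^ 2 * (1 + f) ^ 2 = -(φ - a₀) * ((φ - a₀) + Nζ * ((1 - f) * (1 + f))) := by
          rw [ha₀, hNζ]; ring
        rw [e, map_mul, Valuation.map_neg]
        calc Valued.v (φ - a₀) * Valued.v ((φ - a₀) + Nζ * ((1 - f) * (1 + f)))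
            ≤ Valued.v ϖ ^ ρ * 1 := mul_le_mul' hφa ((Valuation.map_add _ _ _).trans (max_le (hφa.trans hϖρ1.le) hvu.le))
          _ = Valued.v ϖ ^ ρ := mul_one _
      · -- `|F φ − F φ′| = |φ − φ′|·|h φ + Nζ + φ′| = |φ − φ′|`
        have e : (φ - f * Nζ * (2 + f)) * (-(Nζ + φ)) - (φ' - f * Nζ * (2 + f)) * (-(Nζ + φ')) =
            -(φ - φ') * (Nζ * ((1 - f) * (1 + f)) + ((φ - a₀) + (φ' - a₀))) := by rw [ha₀, hNζ]; ring
        have hunit : Valued.v (Nζ * ((1 - f) * (1 + f)) + ((φ - a₀) + (φ' - a₀))) = 1 :=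
          v_add_eq_one_of_lt hvu ((Valuation.map_add _ _ _).trans_lt (max_lt (hφa.trans_lt hϖρ1) (hφ'a.trans_lt hϖρ1)))
        rw [e, map_mul, Valuation.map_neg, hunit, mul_one]
    · obtain ⟨hσφ, hvφ⟩ := hR1 φ hφ.1
      obtain ⟨⟨hσn, hvn, -⟩, ⟨hσh, hvh, -⟩⟩ := hball hσφ hvφ hφ.2
      obtain ⟨-, -, e3, -⟩ := near_letters_table (σ := σ) hϖ1.le (ρ := ρ) (ζ := ζ) (f := f) hvφ hφ.2
      have hσH : σ (φ - f * (ζ * σ ζ) * (2 + f) - (f * (ζ * σ ζ) - φ) ^ 2 / φ) = φ - f * (ζ * σ ζ) * (2 + f) - (f * (ζ * σ ζ) - φ) ^ 2 / φ := by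
        simp only [map_sub, map_mul, map_add, map_div₀, map_pow, map_ofNat, hσ, hσf, hσφ, mul_comm (σ ζ) ζ]
      have hn0 : -(Nζ + φ) ≠ 0 := fun h => by rw [h, map_zero] at hvn; exact zero_ne_one hvn
      have hh0 : φ - f * Nζ * (2 + f) ≠ 0 := fun h => by rw [h, map_zero] at hvh; exact zero_ne_one hvh
      rw [normSign_eq_of_near hD hσh hσH hvh h2ρ (by rw [← Valuation.map_neg, neg_sub]; exact e3), ← normSign_mul_of_fixed hD hσh hσn hh0 hn0]

/-! ## §4  HEAD: the type-2 κ-count of a core-hanging frame lattice with exact invariant `f` -/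

/-- **THE TYPE-2 κ-COUNT OF A CORE-HANGING FRAME LATTICE** (letter 44d44a13 §3; LH4-p09 (g3) 4ddd76e2 «=»): for the datum (`|2| < 1`, complete `K`, finite residue field, the wild
trace bound), `ρ ≥ 1`, units `x, ζ`, a FIXED unit `f` with `|1 + f| = 1`, and `M = latt (1 0 0; x ϖ^ρ 0; xζ + f·xζ ϖ^ρζ ϖ^{2ρ+1})` (every member of the unit-torus orbit of
`latt V₂(1,1,f)`, ★ (A) `exists_coreHanging_of_mem_orbit … (ϖ ^ ρ) (ϖ ^ (2 * ρ + 1))`):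
`kappaCount σ ϖ 2 i M = if 2d − 1 ≤ ρ then n₂(ρ)·(ω(−(1+f)), ω(f)·ω(−(1+f)), ω(f))_i else 0`, `n₂(ρ) = q^{(ρ+2)∕2 − (ρ+1)∕2}` (= ★ (iii)₂(b) `polarisationCount`).  Regimes: `2d−1 ≤ ρ`
— alive, `n₂(ρ)` classes of sign `χ^H_i(f)` each (§3 (b), A1₂ enumeration); `ρ = 2d−2` — alive but the class signs cancel (§3 (c)); `ρ ≤ 2d−3` — dead (§1, A1₂ §0).
[cite: Kottwitz1986BaseChangeUnits, §1 pp. 240–241] [cite: Rogawski1990, §4.9 Prop. 4.9.1 (a) p. 55; §4.10 p. 58] [cite: LanglandsShelstad1987, §3] -/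
theorem kappaCount_two_latt_coreHanging_eq [CompleteSpace K] [Finite 𝓀[K]] {σ : K →+* K} {ϖ : K} {d t : ℕ}
    (hD : IsRamifiedQuadraticDatum σ ϖ d t) (h2 : Valued.v (2 : K) < 1) (hTr : ∀ a : K, Valued.v (a + σ a) ≤ Valued.v ϖ * Valued.v a)
    {ρ : ℕ} (hρ : 1 ≤ ρ) {x ζ f : K} (hx : Valued.v x = 1) (hζ : Valued.v ζ = 1) (hσf : σ f = f) (hf : Valued.v f = 1) (h1f : Valued.v (1 + f) = 1)
    (V : GL (Fin 3) K) (hV : (V : Matrix (Fin 3) (Fin 3) K) = !![1, 0, 0; x, ϖ ^ ρ, 0; x * ζ + f * (x * ζ), ϖ ^ ρ * ζ, ϖ ^ (2 * ρ + 1)]) (i : Fin 3) :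
    kappaCount σ ϖ 2 i (latt (V : Matrix (Fin 3) (Fin 3) K)) =
      if 2 * d - 1 ≤ ρ then
        ((Nat.card 𝓀[K] ^ ((ρ + 2) / 2 - (ρ + 1) / 2) : ℕ) : ℤ) * (![normSign σ (-(1 + f)), normSign σ f * normSign σ (-(1 + f)), normSign σ f] : Fin 3 → ℤ) i
      else 0 := by
  classical
  obtain ⟨hσ, hvσ, hϖ, hfix, hd, -, -⟩ := id hD
  have hd2 : 2 ≤ d := two_le_d_of_v_two_lt_one hD h2
  obtain ⟨c₀, hσc₀, hc₀n, hdich⟩ := exists_nonnorm_dichotomy hD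
  obtain ⟨⟨hσa, hva⟩, -, -, -⟩ := centre_letters hσ hvσ hζ hσf hf h1f
  -- representatives of the fixed units modulo `𝔭^{ρ+1}` and the class `R₀` of `fNζ`
  obtain ⟨R, hRfin, -, hR1, hR2, hR3⟩ := exists_fixed_class_representatives hσ hvσ hfix hϖ hd (ρ + 1) 0 (by omega)
  simp only [Nat.mul_zero, pow_zero, Nat.add_zero] at hR1 hR2 hR3
  have hR₀fin : {φ ∈ R | Valued.v (φ - f * (ζ * σ ζ)) ≤ Valued.v ϖ ^ ρ}.Finite := hRfin.subset (Set.sep_subset _ _)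
  have hcount : {φ ∈ R | Valued.v (φ - f * (ζ * σ ζ)) ≤ Valued.v ϖ ^ ρ}.ncard = Nat.card 𝓀[K] ^ ((ρ + 2) / 2 - (ρ + 1) / 2) :=
    ncard_reps_near_eq hσ hvσ hfix hϖ hd hρ hRfin hR1 hR2 hR3 hσa hva
  by_cases hal : 2 * d - 1 ≤ ρ
  · -- regime (b): alive, every class has sign `χ^H_i(f)`
    rw [if_pos hal, kappaCount_two_latt_coreHanging_eq_finsum_table hσ hvσ hfix hϖ hTr hσc₀ hc₀n hdich ρ hρ hx hζ hσf hf h1f V hV hRfin hR1 hR2 hR3 i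
        (fun u hu => chiVec_eq_one_of_mem_fixedUnitStabilizer_corner hD ρ 1 hx hζ hf V hV (by omega) hu i),
      finsum_mem_congr rfl (fun φ hφ => table_eq_chiH_of_le hD hal hζ hσf hf h1f (hR1 φ hφ.1).1 (hR1 φ hφ.1).2 hφ.2 i),
      finsum_mem_eq_finite_toFinset_sum _ hR₀fin, Finset.sum_const, ← Set.ncard_eq_toFinset_card _ hR₀fin, hcount, nsmul_eq_mul]
  · rw [if_neg hal]
    by_cases hbd : 2 * d - 1 ≤ ρ + 1
    · -- regime (c): `ρ = 2d − 2`, alive, the class signs cancel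
      rw [kappaCount_two_latt_coreHanging_eq_finsum_table hσ hvσ hfix hϖ hTr hσc₀ hc₀n hdich ρ hρ hx hζ hσf hf h1f V hV hRfin hR1 hR2 hR3 i
        (fun u hu => chiVec_eq_one_of_mem_fixedUnitStabilizer_corner hD ρ 1 hx hζ hf V hV hbd hu i)]
      exact finsum_table_eq_zero_of_boundary hD h2 hρ hbd (by omega) hζ hσf hf h1f hRfin hR1 hR2 hR3 i
    · -- regime (a): dead
      exact kappaCount_eq_zero_of_exists_mem_fixedUnitStabilizer σ hσc₀ hc₀n hdich ϖ 2 i _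
        (exists_mem_fixedUnitStabilizer_chiVec_ne_one_corner hD h2 ρ 1 hx hζ hσf hf h1f V hV (by omega) i)

/-! ## §5  The root stratum `H(1)` (`ρ = 0`) is κ-dead -/

/-- **`kappaCount σ ϖ 2 i (latt W) = 0` ON THE ROOT STRATUM `H(1)`** (`W = (1 0 0; 0 1 0; y ζ ϖ)`, `y, ζ` units, ★ (H1a); `|2| < 1`, complete `K`, finite residue field): the stabiliser is
`S_F(latt W) = {u ∈ 𝒰^σ : |u₂−u₁| ≤ |ϖ|, |u₂−u₀| ≤ |ϖ|}` (★ `mem_latticeStabilizer_latt_rhoZero_iff` at `s = 0`, `c = 1`) and contains `(1, c, 1)`, `(c, 1, 1)` for the break-level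
non-norm `c` (`|c−1| ≤ |ϖ|^{2d−2} ≤ |ϖ|`, `d ≥ 2`), so every slot is dead and A1₂ §0 applies — although `polarisationCount = q − 2` (★ (H1b)).
[cite: Kottwitz1986BaseChangeUnits, §1 pp. 240–241] [cite: Serre1979, Ch. V §3 Cor. 3] [cite: LanglandsShelstad1987, §3] -/
theorem kappaCount_two_latt_rhoZeroH_eq_zero [CompleteSpace K] [Finite 𝓀[K]] {σ : K →+* K} {ϖ : K} {d t : ℕ}
    (hD : IsRamifiedQuadraticDatum σ ϖ d t) (h2 : Valued.v (2 : K) < 1)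
    {y ζ : K} (hy : Valued.v y = 1) (hζ : Valued.v ζ = 1)
    (W : GL (Fin 3) K) (hW : (W : Matrix (Fin 3) (Fin 3) K) = !![1, 0, 0; 0, 1, 0; y, ζ, ϖ]) (i : Fin 3) :
    kappaCount σ ϖ 2 i (latt (W : Matrix (Fin 3) (Fin 3) K)) = 0 := by
  obtain ⟨hσ, hvσ, hϖ, hfix, hd, -, -⟩ := id hD
  obtain ⟨hϖ0, hϖ1⟩ := ne_zero_and_v_lt_one_of_v_eq_exp hϖ
  have hd2 : 2 ≤ d := two_le_d_of_v_two_lt_one hD h2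
  obtain ⟨c₀, hσc₀, hc₀n, hdich⟩ := exists_nonnorm_dichotomy hD
  obtain ⟨c, hσc, hc1, hcd, hcn⟩ := exists_fixed_unit_not_norm_v_sub_one_le hD h2
  have hcϖ : Valued.v (1 - c) ≤ Valued.v ϖ ^ 1 := by
    rw [← neg_sub, Valuation.map_neg, pow_one, hϖ]; refine hcd.trans ?_; rw [exp_le_exp]; omega
  have hωc : normSign σ c = -1 := normSign_of_not_isNorm σ hcn
  have hω1 : normSign σ (1 : K) = 1 := normSign_one σ
  obtain ⟨cu, hcu⟩ : ∃ cu : Kˣ, (cu : K) = c := ⟨Units.mk0 c (fun h => by rw [h, map_zero] at hc1; exact zero_ne_one hc1), rfl⟩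
  have hW1 : (W : Matrix (Fin 3) (Fin 3) K) = !![1, 0, 0; 0, 1, 0; y, ζ, ϖ ^ 1] := by rw [pow_one]; exact hW
  -- membership in `S_F(latt W)` from the two congruences
  have key : ∀ {u : Fin 3 → Kˣ}, (∀ j, Valued.v ((u j : Kˣ) : K) = 1) → (∀ j, σ ((u j : Kˣ) : K) = u j) →
      Valued.v (((u 2 : Kˣ) : K) - u 1) ≤ Valued.v ϖ ^ 1 → Valued.v (((u 2 : Kˣ) : K) - u 0) ≤ Valued.v ϖ ^ 1 →
        u ∈ fixedUnitStabilizer σ (latt (W : Matrix (Fin 3) (Fin 3) K)) := fun {u} hu1 hu2 h21 h20 =>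
    (mem_fixedUnitStabilizer_iff σ _ u).2 ⟨(mem_latticeStabilizer_iff _ u).1
      ((mem_latticeStabilizer_latt_rhoZero_iff hϖ0 (s := 0) (c := 1) (by omega) hζ (by rw [pow_zero]; exact hy) W hW1 u hu1).2
        ⟨h21, by rw [Nat.sub_zero]; exact h20⟩), hu1, hu2⟩
  have hvals : ∀ j, Valued.v (((![1, cu, 1] : Fin 3 → Kˣ) j : Kˣ) : K) = 1 := fun j => by
    fin_cases j
    · show Valued.v ((1 : Kˣ) : K) = 1; rw [Units.val_one, map_one]
    · show Valued.v (cu : K) = 1; rw [hcu]; exact hc1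
    · show Valued.v ((1 : Kˣ) : K) = 1; rw [Units.val_one, map_one]
  have hfixs : ∀ j, σ ((((![1, cu, 1] : Fin 3 → Kˣ) j : Kˣ) : K)) = ((![1, cu, 1] : Fin 3 → Kˣ) j : Kˣ) := fun j => by
    fin_cases j
    · show σ ((1 : Kˣ) : K) = (1 : Kˣ); rw [Units.val_one, map_one]
    · show σ (cu : K) = cu; rw [hcu]; exact hσc
    · show σ ((1 : Kˣ) : K) = (1 : Kˣ); rw [Units.val_one, map_one]
  have hvals' : ∀ j, Valued.v (((![cu, 1, 1] : Fin 3 → Kˣ) j : Kˣ) : K) = 1 := fun j => by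
    fin_cases j
    · show Valued.v (cu : K) = 1; rw [hcu]; exact hc1
    · show Valued.v ((1 : Kˣ) : K) = 1; rw [Units.val_one, map_one]
    · show Valued.v ((1 : Kˣ) : K) = 1; rw [Units.val_one, map_one]
  have hfixs' : ∀ j, σ ((((![cu, 1, 1] : Fin 3 → Kˣ) j : Kˣ) : K)) = ((![cu, 1, 1] : Fin 3 → Kˣ) j : Kˣ) := fun j => by
    fin_cases j
    · show σ (cu : K) = cu; rw [hcu]; exact hσc
    · show σ ((1 : Kˣ) : K) = (1 : Kˣ); rw [Units.val_one, map_one]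
    · show σ ((1 : Kˣ) : K) = (1 : Kˣ); rw [Units.val_one, map_one]
  have hmem : (![1, cu, 1] : Fin 3 → Kˣ) ∈ fixedUnitStabilizer σ (latt (W : Matrix (Fin 3) (Fin 3) K)) :=
    key hvals hfixs (by show Valued.v (((1 : Kˣ) : K) - cu) ≤ _; rw [Units.val_one, hcu]; exact hcϖ)
      (by show Valued.v (((1 : Kˣ) : K) - (1 : Kˣ)) ≤ _; rw [sub_self, map_zero]; exact zero_le)
  have hmem' : (![cu, 1, 1] : Fin 3 → Kˣ) ∈ fixedUnitStabilizer σ (latt (W : Matrix (Fin 3) (Fin 3) K)) :=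
    key hvals' hfixs' (by show Valued.v (((1 : Kˣ) : K) - (1 : Kˣ)) ≤ _; rw [sub_self, map_zero]; exact zero_le)
      (by show Valued.v (((1 : Kˣ) : K) - cu) ≤ _; rw [Units.val_one, hcu]; exact hcϖ)
  refine kappaCount_eq_zero_of_exists_mem_fixedUnitStabilizer σ hσc₀ hc₀n hdich ϖ 2 i _ ?_
  fin_cases i
  · refine ⟨![1, cu, 1], hmem, ?_⟩
    rw [chiVec_apply]
    show normSign σ (cu : K) * normSign σ ((1 : Kˣ) : K) ≠ 1
    rw [hcu, Units.val_one, hωc, hω1]; norm_num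
  · refine ⟨![cu, 1, 1], hmem', ?_⟩
    rw [chiVec_apply]
    show normSign σ (cu : K) * normSign σ ((1 : Kˣ) : K) ≠ 1
    rw [hcu, Units.val_one, hωc, hω1]; norm_num
  · refine ⟨![1, cu, 1], hmem, ?_⟩
    rw [chiVec_apply]
    show normSign σ ((1 : Kˣ) : K) * normSign σ (cu : K) ≠ 1
    rw [hcu, Units.val_one, hωc, hω1]; norm_num
end Summit.HodgeConjecture.HodgeConjecture.Cruxes.H413.F0P3cDyRamDiagonalKappaCoreHangingTwoClass

end
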